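/-
Chen 2024 (IACR ePrint 2024/555, version of 2024-04-18), eq. (12) p. 17 + eq. (39) p. 36 + Cond. C.3 p. 18:
the PLANTED CRT SLOTS of `b*` — the Bezout hypothesis of the Step-9 verdict discharged.

HONEST FRAMING: the VALUE is a THEOREM / DECIDABLE VERDICT / CERTIFICATE / precise negative result — NOT
summit progress.  Theorems about a WITHDRAWN algorithm; nothing is repaired, nothing is broken, no
cryptanalytic claim.  No named fact is introduced (debt 0).
-/
import Literature.Computability.Cryptography.ChenQuantumLWEStepNineVerdict

/-!
# Chen 2024, eq. (39): the planted slots make `b*_η` a unit modulo `Q` (REFEREE R-59.2 discharged)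

`ChenQuantumLWEStepNineVerdict` (`Shape.step9_verdict`, `Shape.quantum_subroutine_verdict`) carries the
explicit Bezout hypothesis `hw : Σ_t w_t·b*[t+1] ≡ 1 (mod Q)` — genuine and load-bearing (if
`b*[2..n+1] ≡ 0 (mod Q)` eq. (41) degenerates), and NOT a consequence of `Shape.Admissible`, which records
of `b*` only `b*₁ = Q` and `p₁ ∣ b*_i` (`i ≥ 2`).  The referee (REFEREE.md §136, R-59.2) asked that the hand
claim "every `b*_η`, `2 ≤ η ≤ κ`, is a unit modulo `Q`" be carried with its page references.  This module
puts it in the tree instead.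

WHAT CHEN'S TEXT SAYS (eq. (12) p. 17, eq. (39) p. 36, C.3 p. 18).  `b = [−1, 2p₁p₂, …, 2p₁p_κ,
2p₁sᵀ_{[κ..ℓ]}, 2p₁eᵀ]ᵀ` (eq. (12): the first `κ − 1` secret coordinates are CHOSEN to be `p₂, …, p_κ`);
`D, p₁, …, p_κ` odd and pairwise coprime, `Q := p₂⋯p_κ` (C.3); and after the CRT-slot swap of (9.b),
for `η ∈ {2, …, κ}` (eq. (39)):
  `2D²b*_η := CRT((2D²b_η)_{D²p₁}, (2D²b_η)_{p₂}, …, (2D²b₁)_{p_η}, …, (2D²b_η)_{p_κ})`,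
i.e. (dividing by the unit `2D²`) `b*_η ≡ b₁ = −1 (mod p_η)` and `b*_η ≡ b_η = 2p₁p_η (mod p_η′)` for
`η′ ∈ {2, …, κ} ∖ {η}`; the remaining coordinates `b*_{[κ+1..n+1]} = b_{[κ+1..n+1]}` carry the unknowns.

WHAT IS PROVED.  `Shape.Planted` records exactly these congruences for the abstract `Shape.bstar`
(a factorisation `Q = ∏_η p_η` into pairwise coprime moduli, the planted tail coordinates `slot η`, and the
two congruences).  Then, for an admissible shape:
* `Planted.pos` — there is at least one planted slot (`Q ≥ 3` forces `κ ≥ 2`);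
* `Planted.odd_p`, `Planted.coprime_p₁_p` — each `p_η` is odd and coprime to `p₁` (from C.3 as recorded
  in `Admissible`: `Q` odd, `p₁ ⊥ Q`);
* `isCoprime_bstar_slot` — `b*_{slot η}` is coprime to every `p_η′` (`η′ = η`: it is `≡ −1`; `η′ ≠ η`: it
  is `≡ 2p₁p_η`, a product of three numbers coprime to `p_η′`);
* **`isUnit_bstar_slot`** — `b*_{slot η}` is a unit modulo `Q`  (the hand claim of R-59.2);
* **`exists_bezout_planted`** — hence the Bezout witness of `step9_verdict` exists;
* **`step9_verdict_planted`**, **`quantum_subroutine_verdict_planted`** — the verdicts of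
  `ChenQuantumLWEStepNineVerdict` with the Bezout hypothesis REPLACED by the planted-slot data;
* `toy`, `toy_admissible`, `toyPlanted` — non-vacuity: the `κ = 3` instance `(D, p₁, p₂, p₃) = (1, 3, 5, 7)`,
  `b = (−1, 30, 42)`, `b* = (35, 9, 27)` (computed from eq. (39) by hand: `9 ≡ 0, −1, 2·3·5 (mod 3, 5, 7)`,
  `27 ≡ 0, 2·3·7, −1 (mod 3, 5, 7)`) satisfies `Admissible` and `Planted`, all fields kernel-decided.

NOT CLAIMED.  That Chen's concrete CRT formula produces an integer vector with these congruences is the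
Chinese remainder theorem and is not re-derived (the structure takes the congruences as data, exactly as
`Shape` takes `b*₁ = Q`); the coordinates `κ+1, …, n+1` of `b*` are unconstrained here, as in the paper.
[cite: ChenQuantumLattice2024, eq. (12) p. 17, Cond. C.3 p. 18, eq. (39) p. 36, eq. (41) p. 38]
-/

namespace Literature.Computability.Cryptography.Chen2024

namespace Shape

variable (S : Shape)

/-- Eq. (39)'s planted CRT slots, as congruences on the abstract `b*` of a `Shape`: a factorisation
`Q = ∏_η p_η` (`η` ranges over the `κ − 1` planted primes `p₂, …, p_κ`) into pairwise coprime moduli, the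
planted tail coordinates `slot η` (the paper's coordinates `2, …, κ`, here indices into the `n` tail
coordinates), and `b*_{slot η} ≡ −1 (mod p_η)`, `b*_{slot η} ≡ 2p₁p_η (mod p_η′)` (`η′ ≠ η`).
[cite: ChenQuantumLattice2024, eq. (12) p. 17, Cond. C.3 p. 18, eq. (39) p. 36] -/
structure Planted where
  /-- the number `κ − 1` of planted primes beyond `p₁` -/
  k : ℕ
  /-- the planted moduli `p₂, …, p_κ` -/
  p : Fin k → ℕ
  /-- `Q = p₂⋯p_κ` (C.3) -/
  prod_eq : ∏ η, p η = (S.Q : ℕ)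
  /-- pairwise coprime (C.3) -/
  coprime : ∀ η η', η ≠ η' → Nat.Coprime (p η) (p η')
  /-- the planted coordinates among the tail coordinates -/
  slot : Fin k → Fin S.n
  /-- distinct coordinates -/
  slot_injective : Function.Injective slot
  /-- eq. (39): the slot of `p_η` in `b*_η` holds `b₁ = −1` -/
  bstar_self : ∀ η, ((S.bstar (Fin.succ (slot η)) : ℤ) : ZMod (p η)) = -1
  /-- eq. (39) with eq. (12): the slot of `p_η′`, `η′ ≠ η`, in `b*_η` holds `b_η = 2p₁p_η` -/
  bstar_other : ∀ η η', η ≠ η' →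
    ((S.bstar (Fin.succ (slot η)) : ℤ) : ZMod (p η')) = ((2 * (S.p₁ : ℕ) * p η : ℕ) : ℤ)

namespace Planted

variable {S} (Pl : S.Planted)

/-- Each planted modulus divides `Q`. [cite: ChenQuantumLattice2024, Cond. C.3 p. 18] -/
theorem p_dvd_Q (η : Fin Pl.k) : Pl.p η ∣ (S.Q : ℕ) := by
  rw [← Pl.prod_eq]
  exact Finset.dvd_prod_of_mem _ (Finset.mem_univ η)

/-- An admissible shape has at least one planted slot: `Q ≥ 3`, so `κ ≥ 2`.
[cite: ChenQuantumLattice2024, Cond. C.3 p. 18] -/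
theorem pos (h : S.Admissible) : 0 < Pl.k := by
  by_contra hk
  have hk0 : Pl.k = 0 := Nat.eq_zero_of_not_pos hk
  have hprod : ∏ η, Pl.p η = 1 := by
    have : IsEmpty (Fin Pl.k) := by rw [hk0]; infer_instance
    exact Finset.prod_of_isEmpty _
  have h3 := h.three_le_Q
  rw [← Pl.prod_eq, hprod] at h3
  omega

/-- Each planted modulus is odd (`Q` is odd). [cite: ChenQuantumLattice2024, Cond. C.3 p. 18] -/
theorem odd_p (h : S.Admissible) (η : Fin Pl.k) : Odd (Pl.p η) :=
  Odd.of_dvd_nat h.odd_Q (Pl.p_dvd_Q η)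

/-- Each planted modulus is coprime to `p₁`. [cite: ChenQuantumLattice2024, Cond. C.3 p. 18] -/
theorem coprime_p₁_p (h : S.Admissible) (η : Fin Pl.k) : Nat.Coprime (S.p₁ : ℕ) (Pl.p η) :=
  Nat.Coprime.coprime_dvd_right (Pl.p_dvd_Q η) h.cop_pQ

/-- `2p₁p_η` is coprime to `p_η′` for `η′ ≠ η`. [cite: ChenQuantumLattice2024, Cond. C.3 p. 18] -/
theorem coprime_two_mul (h : S.Admissible) {η η' : Fin Pl.k} (hne : η ≠ η') :
    Nat.Coprime (2 * (S.p₁ : ℕ) * Pl.p η) (Pl.p η') :=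
  Nat.Coprime.mul_left (Nat.Coprime.mul_left (Nat.coprime_two_left.2 (Pl.odd_p h η')) (Pl.coprime_p₁_p h η'))
    (Pl.coprime η η' hne)

end Planted

/-- `b*_{slot η}` is coprime to every planted modulus `p_η′`: for `η′ = η` it is `≡ −1`, for `η′ ≠ η` it is
`≡ 2p₁p_η`, coprime to `p_η′`. [cite: ChenQuantumLattice2024, eq. (39) p. 36, Cond. C.3 p. 18] -/
theorem isCoprime_bstar_slot (h : S.Admissible) (Pl : S.Planted) (η η' : Fin Pl.k) :
    IsCoprime (S.bstar (Fin.succ (Pl.slot η))) (Pl.p η' : ℤ) := by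
  by_cases hne : η = η'
  · subst hne
    have hc := Pl.bstar_self η
    have hdvd : ((Pl.p η : ℕ) : ℤ) ∣ (-1) - S.bstar (Fin.succ (Pl.slot η)) :=
      (ZMod.intCast_eq_intCast_iff_dvd_sub _ _ _).1 (by push_cast; exact hc)
    obtain ⟨c, hc'⟩ := hdvd
    have hb : S.bstar (Fin.succ (Pl.slot η)) = -1 + (Pl.p η : ℤ) * (-c) := by linarith
    rw [hb]
    exact (isCoprime_one_left.neg_left).add_mul_left_left (-c)
  · have hc := Pl.bstar_other η η' hne
    have hdvd : ((Pl.p η' : ℕ) : ℤ) ∣ ((2 * (S.p₁ : ℕ) * Pl.p η : ℕ) : ℤ) - S.bstar (Fin.succ (Pl.slot η)) :=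
      (ZMod.intCast_eq_intCast_iff_dvd_sub _ _ _).1 hc
    obtain ⟨c, hc'⟩ := hdvd
    have hb : S.bstar (Fin.succ (Pl.slot η)) = ((2 * (S.p₁ : ℕ) * Pl.p η : ℕ) : ℤ) + (Pl.p η' : ℤ) * (-c) := by
      linarith
    rw [hb]
    exact (Nat.isCoprime_iff_coprime.2 (Pl.coprime_two_mul h hne)).add_mul_left_left (-c)

/-- **The hand claim of R-59.2, in the tree**: every planted coordinate of `b*` is a unit modulo `Q`.
[cite: ChenQuantumLattice2024, eq. (39) p. 36, Cond. C.3 p. 18] -/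
theorem isUnit_bstar_slot (h : S.Admissible) (Pl : S.Planted) (η : Fin Pl.k) :
    IsUnit ((S.bstar (Fin.succ (Pl.slot η)) : ℤ) : ZMod S.Q) := by
  rw [ZMod.coe_int_isUnit_iff_isCoprime, isCoprime_comm]
  have hQ : ((S.Q : ℕ) : ℤ) = ∏ η', (Pl.p η' : ℤ) := by
    rw [← Pl.prod_eq]; push_cast; rfl
  rw [hQ]
  exact IsCoprime.prod_right fun η' _ => S.isCoprime_bstar_slot h Pl η η'

/-- Hence the Bezout witness of `step9_verdict` exists for every admissible shape with planted slots.
[cite: ChenQuantumLattice2024, eq. (39) p. 36, eq. (41) p. 38] -/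
theorem exists_bezout_planted (h : S.Admissible) (Pl : S.Planted) :
    ∃ w : Fin S.n → ℤ, ((∑ t, w t * S.bstar (Fin.succ t) : ℤ) : ZMod S.Q) = 1 :=
  S.exists_bezout_of_isUnit (Pl.slot ⟨0, Pl.pos h⟩) (S.isUnit_bstar_slot h Pl ⟨0, Pl.pos h⟩)

/-- **Step 9 decided, Bezout hypothesis discharged by the planted slots** (= `step9_verdict` with `hw`
supplied by `exists_bezout_planted`): (1) product structure of eq. (40); (2) the displayed state is not
produced; (3) eq. (41) is not certain for `|φ8.f⟩` nor after any isometric coordinate-1 processing;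
(4) the exact law `Pr_K[(41)] = Pr_K[p₁ ∣ u₁]/Q ≤ 1/Q`; (5) the two runs of interest; (6) instance
independence. [cite: ChenQuantumLattice2024, §3.5.9 pp. 34–38, eq. (39) p. 36, eq. (41) p. 38] -/
theorem step9_verdict_planted (h : S.Admissible) [DecidablePred S.eq41] (Pl : S.Planted) :
    IsProduct (splitFirst S.phi8f) ∧
    ¬ S.Step9Display ∧
    (¬ S.Lemma38Certainty S.phi8f ∧
      ∀ K : Matrix (ZMod S.N) (ZMod S.N) ℂ, star K * K = 1 → ¬ S.Lemma38Certainty (S.processed K)) ∧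
    ((∀ K : ZMod S.N → ZMod S.N → ℂ, S.probEq41 K = S.probHeadDvd K / S.Q) ∧
      ∀ K : ZMod S.N → ZMod S.N → ℂ, S.processed K ≠ 0 → S.probEq41 K ≤ 1 / S.Q) ∧
    (S.probEq41 (fun x y => if x = y then 1 else 0) = 1 / (S.P : ℕ) ∧
      S.probHeadDvd S.honestKernel = 1 ∧ S.probEq41 S.honestKernel = 1 / S.Q ∧
      ∀ (u₀ : ZMod S.N) (u' : Fin S.n → ZMod S.N),
        ‖qft (S.processed S.honestKernel) (Fin.cons u₀ u')‖ ^ 2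
            / ∑ u, ‖qft (S.processed S.honestKernel) u‖ ^ 2
          = (if (S.p₁ : ℕ) ∣ u₀.val then ((S.p₁ : ℕ) : ℝ) else 0) / ((S.N : ℕ) : ℝ) ^ (S.n + 1)) ∧
    (∀ (b₂ v₂ c₂ w₂ : Fin (S.n + 1) → ℤ), (S.withVectors b₂ v₂ c₂ w₂).Admissible →
      ∀ (K : ZMod S.N → ZMod S.N → ℂ) (u : Fin (S.n + 1) → ZMod S.N),
        ‖qft ((S.withVectors b₂ v₂ c₂ w₂).processed K) u‖ ^ 2
            / ∑ v : Fin (S.n + 1) → ZMod S.N, ‖qft ((S.withVectors b₂ v₂ c₂ w₂).processed K) v‖ ^ 2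
          = ‖qft (S.processed K) u‖ ^ 2 / ∑ v, ‖qft (S.processed K) v‖ ^ 2) := by
  obtain ⟨w, hw⟩ := S.exists_bezout_planted h Pl
  exact S.step9_verdict h w hw

/-- **The quantum subroutine's two load-bearing lemmas decided, Bezout hypothesis discharged**
(= `quantum_subroutine_verdict` with `hw` supplied by `exists_bezout_planted`).
[cite: ChenQuantumLattice2024, §3.5.8 pp. 32–34, §3.5.9 pp. 34–38, eq. (39) p. 36] -/
theorem quantum_subroutine_verdict_planted (h : S.Admissible) (U : Finset (Fin (S.n + 1)))
    [DecidablePred S.eq41] (Pl : S.Planted) :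
    (S.Claim314 S.phi7d
      ∧ ((∀ r, S.fifthOp r S.phi7d = if r = S.read8Value then S.phi7d else 0)
          ∧ S.step8Output = ((((S.D : ℕ) * S.read8Value.val : ℕ)) : ZMod ((S.D : ℕ) ^ 2 * S.p₁))
          ∧ ∃ c : ℂ, c ≠ 0 ∧ S.reverse8 (S.fifthOp S.read8Value S.phi7d) = c • S.phi7)
      ∧ ((S.inst S.b S.shiftV).Admissible ∧ (S.inst S.b S.shiftV).step8Output = S.step8Output
          ∧ (S.inst S.b S.shiftV).step9Needs ≠ S.step9Needs)
      ∧ ((∀ {κ : Type} [Fintype κ] [DecidableEq κ] (t₁ : Fin S.n), t₁.succ ∈ U →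
            ∀ (E : POVM (Fin (S.n + 1) → ZMod S.M) κ) {ε : ℝ},
              (∀ p ∈ (S.Q : ℕ).primeFactors, ε * ((p : ℝ) ^ 2 + 1) < 1) → S.AlmostSureOn ε U E →
                ∀ k k' : κ, E.AlmostCertain ε S.phi7d k →
                  E.AlmostCertain ε (S.inst S.b S.shiftV).phi7d k' → k = k')
          ∧ ∀ p ∈ (S.Q : ℕ).primeFactors, ∃ (E : POVM (Fin (S.n + 1) → ZMod S.M) (Fin 2)) (k k' : Fin 2),
              S.AlmostSureOn (1 / ((p : ℝ) ^ 2 + 1)) U E ∧ k ≠ k'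
              ∧ E.AlmostCertain (1 / ((p : ℝ) ^ 2 + 1)) S.phi7d k
              ∧ E.AlmostCertain (1 / ((p : ℝ) ^ 2 + 1)) (S.inst S.b S.shiftV).phi7d k')
      ∧ (∀ {κ : Type} [Fintype κ] [DecidableEq κ] (k₀ k₁ : κ), k₀ ≠ k₁ → ∀ t₁ : Fin S.n, t₁.succ ∈ U →
          ∀ ε : ℝ,
            (∀ E : POVM (Fin (S.n + 1) → ZMod S.M) κ, S.AlmostSureOn ε U E →
                ∀ k k' : κ, E.AlmostCertain ε S.phi7d k →
                  E.AlmostCertain ε (S.inst S.b S.shiftV).phi7d k' → k = k')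
              ↔ ∀ p ∈ (S.Q : ℕ).primeFactors, ε * ((p : ℝ) ^ 2 + 1) < 1))
    ∧ (IsProduct (splitFirst S.phi8f) ∧
      ¬ S.Step9Display ∧
      (¬ S.Lemma38Certainty S.phi8f ∧
        ∀ K : Matrix (ZMod S.N) (ZMod S.N) ℂ, star K * K = 1 → ¬ S.Lemma38Certainty (S.processed K)) ∧
      ((∀ K : ZMod S.N → ZMod S.N → ℂ, S.probEq41 K = S.probHeadDvd K / S.Q) ∧
        ∀ K : ZMod S.N → ZMod S.N → ℂ, S.processed K ≠ 0 → S.probEq41 K ≤ 1 / S.Q) ∧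
      (S.probEq41 (fun x y => if x = y then 1 else 0) = 1 / (S.P : ℕ) ∧
        S.probHeadDvd S.honestKernel = 1 ∧ S.probEq41 S.honestKernel = 1 / S.Q ∧
        ∀ (u₀ : ZMod S.N) (u' : Fin S.n → ZMod S.N),
          ‖qft (S.processed S.honestKernel) (Fin.cons u₀ u')‖ ^ 2
              / ∑ u, ‖qft (S.processed S.honestKernel) u‖ ^ 2
            = (if (S.p₁ : ℕ) ∣ u₀.val then ((S.p₁ : ℕ) : ℝ) else 0) / ((S.N : ℕ) : ℝ) ^ (S.n + 1)) ∧
      (∀ (b₂ v₂ c₂ w₂ : Fin (S.n + 1) → ℤ), (S.withVectors b₂ v₂ c₂ w₂).Admissible →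
        ∀ (K : ZMod S.N → ZMod S.N → ℂ) (u : Fin (S.n + 1) → ZMod S.N),
          ‖qft ((S.withVectors b₂ v₂ c₂ w₂).processed K) u‖ ^ 2
              / ∑ v : Fin (S.n + 1) → ZMod S.N, ‖qft ((S.withVectors b₂ v₂ c₂ w₂).processed K) v‖ ^ 2
            = ‖qft (S.processed K) u‖ ^ 2 / ∑ v, ‖qft (S.processed K) v‖ ^ 2)) := by
  obtain ⟨w, hw⟩ := S.exists_bezout_planted h Pl
  exact S.quantum_subroutine_verdict h U w hw

/-! ### Non-vacuity: the `κ = 3` toy instance `(D, p₁, p₂, p₃) = (1, 3, 5, 7)` -/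

/-- The toy shape `n = 2`, `D = 1`, `p₁ = 3`, `Q = 35 = 5·7`, `b = (−1, 30, 42)` (eq. (12) with
`(p₂, p₃) = (5, 7)`), `v′ = 0`, `b* = (35, 9, 27)` (eq. (39): `9 ≡ 0, −1, 30 (mod 3, 5, 7)`,
`27 ≡ 0, 42, −1 (mod 3, 5, 7)`), `v* = 0`. [cite: ChenQuantumLattice2024, eq. (12) p. 17, eq. (39) p. 36] -/
def toy : Shape where
  n := 2
  D := 1
  p₁ := 3
  Q := 35
  b := ![-1, 30, 42]
  v' := ![0, 0, 0]
  bstar := ![35, 9, 27]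
  vstar := ![0, 0, 0]

/-- The toy shape is admissible (all of C.3, eq. (12), eq. (39) as recorded in `Admissible`;
kernel-decided field by field). [cite: ChenQuantumLattice2024, Cond. C.3 p. 18] -/
theorem toy_admissible : toy.Admissible where
  odd_D := ⟨0, rfl⟩
  odd_p₁ := ⟨1, rfl⟩
  odd_Q := ⟨17, rfl⟩
  cop_Dp := by decide
  cop_DQ := by decide
  cop_pQ := by decide
  three_le_p₁ := by decide
  three_le_Q := by decide
  Q_mod := by decide
  b_head := rfl
  b_tail := by
    intro i hi
    fin_cases i
    · exact absurd rfl hi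
    · exact ⟨5, by decide⟩
    · exact ⟨7, by decide⟩
  v'_in_DZ := by
    intro i
    fin_cases i <;> exact ⟨0, by decide⟩
  bstar_head := rfl
  bstar_tail := by
    intro i hi
    fin_cases i
    · exact absurd rfl hi
    · exact ⟨3, by decide⟩
    · exact ⟨9, by decide⟩
  vstar_head := rfl

/-- The toy shape's planted slots: `(p₂, p₃) = (5, 7)` at tail coordinates `0, 1`; the four congruences
`9 ≡ −1 (5)`, `27 ≡ −1 (7)`, `9 ≡ 2·3·5 (7)`, `27 ≡ 2·3·7 (5)` kernel-decided.
[cite: ChenQuantumLattice2024, eq. (39) p. 36] -/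
def toyPlanted : toy.Planted where
  k := 2
  p := ![5, 7]
  prod_eq := by decide
  coprime := by decide
  slot := id
  slot_injective := Function.injective_id
  bstar_self := by
    intro η
    fin_cases η <;> decide
  bstar_other := by
    intro η η' hne
    fin_cases η <;> fin_cases η'
    · exact absurd rfl hne
    · decide
    · decide
    · exact absurd rfl hne

/-- Non-vacuity, assembled: in the toy instance `b*₂ = 9` and `b*₃ = 27` are units modulo `35` and the
Bezout witness exists — by the general theorems, not by `decide`. [cite: ChenQuantumLattice2024, eq. (39) p. 36] -/
theorem toy_exists_bezout :
    ∃ w : Fin toy.n → ℤ, ((∑ t, w t * toy.bstar (Fin.succ t) : ℤ) : ZMod toy.Q) = 1 :=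
  toy.exists_bezout_planted toy_admissible toyPlanted

end Shape

end Literature.Computability.Cryptography.Chen2024
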